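import Literature.NumberTheory.Rogawski1990.AdelicCartanClassConverse
import Literature.NumberTheory.QuadraticForms.HermitianCongruenceOfLocalNorms
import HarnessLib

/-!
# The adelic Cartan class read PLACE BY PLACE: a local ∕ archimedean Cartan-class identity forces local ∕
# archimedean `U(H)`-conjugacy of matching adèles (Rogawski 1990, §3.3 (3.3.1); Kottwitz 1986, §7)

Topic `NumberTheory/Rogawski1990`; namespace `Literature.NumberTheory.Rogawski1990`.  THEOREMS ONLY (no definition, no named fact,
no instance, no notation, no `sorry`).  Cell `pub/hodgecm-mathlib`, ENGINE T1 (crux H413 = `stmt-HodgeConjecture-24833`), the «hloc-place»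
piece of the O7 singular road (TRUNK WORDS #5 «PLACEWISE SOCKET», O7 OWNER WORD #7 (i)): the two GENERIC per-place readings `hlocFin` ∕ `hlocArch`
of ★ `MatchingAdeleG₂.obsHasse_of_placewise` (`Rogawski1990/ObsHasseOfStepsSemisimple`, ED. 2), stated with those binders TOKEN FOR TOKEN so the
consumer passes the two heads below by name.  They are ★ A-p10's ADELIC `MatchingAdeleG₂.forall_isConj_toLocal_and_isConj_arch_of_adelicCartan_eq`
with the adelic `t` replaced by its shadow at ONE place — valid for EVERY `γ₀` (regular or singular), since ★ R6a is ring-generic.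
HC_CM is proved only modulo the printed citations until rung 0 closes.

THE MATHEMATICS [Rogawski1990, §3.3 (3.3.1) p. 22; §3.1 p. 19].  For matching adèles `p, q` over `γ₀` with adelic conjugators `g, g′`
(`g (γ₀ ⊗ 1) g⁻¹ = p`, `g′ (γ₀ ⊗ 1) g′⁻¹ = q`), project to a finite place `v` of `L⁺` along `πᵥ : 𝔸_L → L_v = ∏_{w ∣ v} L_w` (★ `adeleToLocal`):
`g_v (γ₀)_v g_v⁻¹ = p_v`, `g′_v (γ₀)_v g′_v⁻¹ = q_v` in `GL₃(L_v)`, and the Cartan letters project to `(x_g)_v = H_v⁻¹ · ᵗ(σ_v g_v) H_v g_v`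
(`map_adeleToLocal_inv_mul_twistGram`; ★ `twistGram_map`, ★ `adeleToLocal_conj`).  If `t ∈ GL₃(L_v)` commutes with `(γ₀)_v` and
`(x_g)_v = t⋆ (x_{g′})_v t`, then ★ R6a `exists_unitary_conj_of_inv_mul_twistGram_eq` over the ring `L_v` produces `u ∈ U(H)(L⁺_v)` with
`u p_v u⁻¹ = q_v`, i.e. `q_v ∼ p_v` in `U(H)(L⁺_v)` (**`MatchingAdeleG₂.isConj_toLocal_of_placewise_cartan_eq`**).  At `∞` the same along
`π_∞ : 𝔸_L → L ⊗ ℝ` (★ `ringEquiv_mixedSpace_fst_adeleConj`, ★ `map_algebraMap_map_arch`, ★ `twistGram_adele_map_arch`; the archimedean component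
`p_∞ = archPart p` IS `GL₃(π_∞) p`, `toMixed_eq_map`): **`MatchingAdeleG₂.isConj_arch_of_placewise_cartan_eq`**.

## References
* [Rogawski1990] J. D. Rogawski, *Automorphic Representations of Unitary Groups in Three Variables*, Ann. of Math. Stud. 123 (1990), §3.1 p. 19,
  §3.3 (3.3.1) p. 22.
* [Kottwitz1986] R. E. Kottwitz, *Stable trace formula: elliptic singular terms*, Math. Ann. 275 (1986), §7.
* [BorelJacquet1979] A. Borel, H. Jacquet, *Automorphic forms and automorphic representations*, Proc. Sympos. Pure Math. 33.1 (1979), §4.1.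
-/

set_option autoImplicit false

noncomputable section

open NumberField NumberField.mixedEmbedding IsDedekindDomain
open scoped Matrix MatrixGroups

namespace Literature.NumberTheory.Rogawski1990

open Literature.NumberTheory.Automorphic
open Literature.NumberTheory.QuadraticForms (ringEquiv_mixedSpace_fst_adeleConj map_algebraMap_map_arch twistGram_adele_map_arch isUnit_det_map_arch)
open Literature.AlgebraicGeometry.ShimuraVarieties (unitaryGroup)

variable {L : Type} [Field L] [NumberField L] [IsCMField L] {H : Matrix (Fin 3) (Fin 3) L} {γ₀ : (UnitaryGroup.cmDatum L 3 H).Rational}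

/-! ## §1 At a finite place `v` of `L⁺` -/

section Finite

omit [IsCMField L] in
/-- `GL₃(πᵥ)` on matrices: the underlying matrix of `GL₃(πᵥ) g` is `g` mapped entrywise. [folklore] -/
private theorem coe_generalLinearGroup_map₃' {R S : Type*} [CommRing R] [CommRing S] (f : R →+* S) (g : GL (Fin 3) R) :
    ((Matrix.GeneralLinearGroup.map f g : GL (Fin 3) S) : Matrix (Fin 3) (Fin 3) S) = (g : Matrix (Fin 3) (Fin 3) R).map f := rfl

omit [IsCMField L] in
/-- `det (H ⊗ 1)_v` is a unit when `det H ≠ 0`. [cite: Rogawski1990, §3.3 p. 21] -/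
theorem isUnit_det_adelicForm_map_adeleToLocal (hHd : H.det ≠ 0) (v : HeightOneSpectrum (𝓞 ↥(maximalRealSubfield L))) :
    IsUnit ((H.map (algebraMap L (AdeleRing (𝓞 L) L))).map (UnitaryGroup.adeleToLocal L v)).det := by
  rw [← RingHom.mapMatrix_apply, ← RingHom.map_det]
  exact (isUnit_det_adelicForm (isUnit_iff_ne_zero.mpr hHd)).map _

/-- **The Cartan letters project along `πᵥ`**: `(x_g)_v = ((H ⊗ 1)⁻¹ · ᵗ(σ_𝔸 g) (H ⊗ 1) g)_v = H_v⁻¹ · ᵗ(σ_v g_v) H_v g_v` with `H_v = (H ⊗ 1)_v`,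
`σ_v = c ⊗ 1` on `L_v` (★ `map_nonsing_inv_of_isUnit`, ★ `twistGram_map`, ★ `adeleToLocal_conj`). [cite: Rogawski1990, §3.3 p. 21] [cite: BorelJacquet1979, §4.1] -/
theorem map_adeleToLocal_inv_mul_twistGram (hHd : H.det ≠ 0) (v : HeightOneSpectrum (𝓞 ↥(maximalRealSubfield L)))
    (g : Matrix (Fin 3) (Fin 3) (AdeleRing (𝓞 L) L)) :
    ((H.map (algebraMap L (AdeleRing (𝓞 L) L)))⁻¹ * twistGram (adeleConj L) (H.map (algebraMap L (AdeleRing (𝓞 L) L))) g).map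
        (UnitaryGroup.adeleToLocal L v) =
      ((H.map (algebraMap L (AdeleRing (𝓞 L) L))).map (UnitaryGroup.adeleToLocal L v))⁻¹ *
        twistGram (UnitaryGroup.conjLocal L (IsCMField.complexConj L) v) ((H.map (algebraMap L (AdeleRing (𝓞 L) L))).map (UnitaryGroup.adeleToLocal L v))
          (g.map (UnitaryGroup.adeleToLocal L v)) := by
  rw [Matrix.map_mul, Literature.LinearAlgebra.Matrix.map_nonsing_inv_of_isUnit _ (isUnit_det_adelicForm (isUnit_iff_ne_zero.mpr hHd)),
    twistGram_map (adeleConj L) _ (UnitaryGroup.conjLocal L (IsCMField.complexConj L) v) _ (fun r => ?_) g]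
  rw [← UnitaryGroup.conjAdele_complexConj]
  exact UnitaryGroup.adeleToLocal_conj L (IsCMField.complexConj L) v r

/-- **`hlocFin` — A LOCAL CARTAN-CLASS IDENTITY FORCES LOCAL CONJUGACY** (any `γ₀`, any finite place `v` of `L⁺`).  For matching adèles `p, q` over
`γ₀` with adelic conjugators `g, g′`, and `t ∈ GL₃(L_v)` commuting with `(γ₀)_v` such that `(x_g)_v = t⋆ · (x_{g′})_v · t`
(`x_g = (H ⊗ 1)⁻¹ ᵗ(σ_𝔸 g)(H ⊗ 1) g`, `t⋆ = H_v⁻¹ ᵗ(σ_v t) H_v`), the components `q_v`, `p_v` are conjugate in `U(H)(L⁺_v)`: project the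
conjugations along `GL₃(πᵥ)`, read the letters through `map_adeleToLocal_inv_mul_twistGram`, and apply ★ R6a `exists_unitary_conj_of_inv_mul_twistGram_eq`
over the ring `L_v` — the unitary `u = g′_v t g_v⁻¹` has `u p_v u⁻¹ = q_v`.  Binders = the `hlocFin` socket of ★ `MatchingAdeleG₂.obsHasse_of_placewise`
token for token. [cite: Rogawski1990, §3.3 (3.3.1) p. 22; §3.1 p. 19] [cite: Kottwitz1986, §7] -/
theorem MatchingAdeleG₂.isConj_toLocal_of_placewise_cartan_eq (hHd : H.det ≠ 0) :
    ∀ (p q : MatchingAdeleG₂ L H H γ₀) (g g' : GL (Fin 3) (AdeleRing (𝓞 L) L)) (v : HeightOneSpectrum (𝓞 ↥(maximalRealSubfield L)))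
        (t : GL (Fin 3) (UnitaryGroup.LocalRing L v)),
      g * (((UnitaryGroup.cmDatum L 3 H).toAdelic γ₀).val : GL (Fin 3) (AdeleRing (𝓞 L) L)) * g⁻¹ = (p.adele.val : GL (Fin 3) (AdeleRing (𝓞 L) L)) →
      g' * (((UnitaryGroup.cmDatum L 3 H).toAdelic γ₀).val : GL (Fin 3) (AdeleRing (𝓞 L) L)) * g'⁻¹ = (q.adele.val : GL (Fin 3) (AdeleRing (𝓞 L) L)) →
      t * Matrix.GeneralLinearGroup.map (UnitaryGroup.adeleToLocal L v) (((UnitaryGroup.cmDatum L 3 H).toAdelic γ₀).val : GL (Fin 3) (AdeleRing (𝓞 L) L)) =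
        Matrix.GeneralLinearGroup.map (UnitaryGroup.adeleToLocal L v) (((UnitaryGroup.cmDatum L 3 H).toAdelic γ₀).val : GL (Fin 3) (AdeleRing (𝓞 L) L)) * t →
      ((H.map (algebraMap L (AdeleRing (𝓞 L) L)))⁻¹ * twistGram (adeleConj L) (H.map (algebraMap L (AdeleRing (𝓞 L) L))) (g : Matrix (Fin 3) (Fin 3) (AdeleRing (𝓞 L) L))).map
          (UnitaryGroup.adeleToLocal L v) =
        hermStar (UnitaryGroup.conjLocal L (IsCMField.complexConj L) v) ((H.map (algebraMap L (AdeleRing (𝓞 L) L))).map (UnitaryGroup.adeleToLocal L v))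
            (t.val : Matrix (Fin 3) (Fin 3) (UnitaryGroup.LocalRing L v)) *
          ((H.map (algebraMap L (AdeleRing (𝓞 L) L)))⁻¹ * twistGram (adeleConj L) (H.map (algebraMap L (AdeleRing (𝓞 L) L))) (g' : Matrix (Fin 3) (Fin 3) (AdeleRing (𝓞 L) L))).map
            (UnitaryGroup.adeleToLocal L v) * (t.val : Matrix (Fin 3) (Fin 3) (UnitaryGroup.LocalRing L v)) →
      IsConj ((UnitaryGroup.cmDatum L 3 H).toLocal v q.adele) ((UnitaryGroup.cmDatum L 3 H).toLocal v p.adele) := by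
  intro p q g g' v t hg hg' ht hx
  -- project the two conjugations along `GL₃(πᵥ)`
  have hgv := congrArg (Matrix.GeneralLinearGroup.map (UnitaryGroup.adeleToLocal L v)) hg
  have hg'v := congrArg (Matrix.GeneralLinearGroup.map (UnitaryGroup.adeleToLocal L v)) hg'
  rw [map_mul, map_mul, map_inv] at hgv hg'v
  -- read the Cartan letters at `v`
  rw [map_adeleToLocal_inv_mul_twistGram hHd, map_adeleToLocal_inv_mul_twistGram hHd, ← coe_generalLinearGroup_map₃', ← coe_generalLinearGroup_map₃'] at hx
  -- ★ R6a over the ring `L_v`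
  obtain ⟨u, hu, huc⟩ := exists_unitary_conj_of_inv_mul_twistGram_eq (UnitaryGroup.conjLocal L (IsCMField.complexConj L) v)
    ((H.map (algebraMap L (AdeleRing (𝓞 L) L))).map (UnitaryGroup.adeleToLocal L v)) (isUnit_det_adelicForm_map_adeleToLocal hHd v) hg'v hgv ht hx
  have hu' : u ∈ UnitaryGroup.«local» L (IsCMField.complexConj L) 3 H v := by
    have h := (twistGram_coe_eq_iff_mem_unitaryGroup _ _ u).mpr hu
    rw [twistGram_def] at h
    exact h
  exact (isConj_iff.mpr ⟨⟨u, hu'⟩, Subtype.ext huc⟩ :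
    IsConj ((UnitaryGroup.cmDatum L 3 H).toLocal v p.adele) ((UnitaryGroup.cmDatum L 3 H).toLocal v q.adele)).symm

end Finite

/-! ## §2 At the archimedean place -/

section Arch

omit [IsCMField L] in
/-- The archimedean component `GLn.toMixed` IS `GL₃(π_∞)` with `π_∞ = (𝔸_L^∞ ≃ L ⊗ ℝ) ∘ pr_∞` (entrywise ★ `GLn.coe_toMixed_apply`). [cite: BorelJacquet1979, §4.1] -/
theorem toMixed_eq_map (g : GL (Fin 3) (AdeleRing (𝓞 L) L)) :
    GLn.toMixed 3 L g = Matrix.GeneralLinearGroup.map ((InfiniteAdeleRing.ringEquiv_mixedSpace L).toRingHom.comp (UnitaryGroup.adeleFst L)) g :=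
  Units.ext (Matrix.ext fun _ _ => rfl)

omit [IsCMField L] in
/-- `det (H ⊗ 1)_∞` is a unit when `det H ≠ 0`. [cite: Rogawski1990, §3.3 p. 21] -/
theorem isUnit_det_adelicForm_map_arch (hHd : H.det ≠ 0) :
    IsUnit ((H.map (algebraMap L (AdeleRing (𝓞 L) L))).map ((InfiniteAdeleRing.ringEquiv_mixedSpace L).toRingHom.comp (UnitaryGroup.adeleFst L))).det :=
  isUnit_det_map_arch L 3 (isUnit_det_adelicForm (isUnit_iff_ne_zero.mpr hHd))

/-- **The Cartan letters project along `π_∞`**: `(x_g)_∞ = ((H ⊗ 1)_∞)⁻¹ · ᵗ((σ ⊗ 1) g_∞) (H ⊗ 1)_∞ g_∞` (★ `map_nonsing_inv_of_isUnit`, ★ `twistGram_map`,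
★ `ringEquiv_mixedSpace_fst_adeleConj`). [cite: Rogawski1990, §3.3 p. 21] [cite: BorelJacquet1979, §4.1] -/
theorem map_arch_inv_mul_twistGram (hHd : H.det ≠ 0) (g : Matrix (Fin 3) (Fin 3) (AdeleRing (𝓞 L) L)) :
    ((H.map (algebraMap L (AdeleRing (𝓞 L) L)))⁻¹ * twistGram (adeleConj L) (H.map (algebraMap L (AdeleRing (𝓞 L) L))) g).map
        ((InfiniteAdeleRing.ringEquiv_mixedSpace L).toRingHom.comp (UnitaryGroup.adeleFst L)) =
      ((H.map (algebraMap L (AdeleRing (𝓞 L) L))).map ((InfiniteAdeleRing.ringEquiv_mixedSpace L).toRingHom.comp (UnitaryGroup.adeleFst L)))⁻¹ *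
        twistGram (UnitaryGroup.conjMixed (↥(maximalRealSubfield L)) L (IsCMField.complexConj L))
          ((H.map (algebraMap L (AdeleRing (𝓞 L) L))).map ((InfiniteAdeleRing.ringEquiv_mixedSpace L).toRingHom.comp (UnitaryGroup.adeleFst L)))
          (g.map ((InfiniteAdeleRing.ringEquiv_mixedSpace L).toRingHom.comp (UnitaryGroup.adeleFst L))) := by
  rw [Matrix.map_mul, Literature.LinearAlgebra.Matrix.map_nonsing_inv_of_isUnit _ (isUnit_det_adelicForm (isUnit_iff_ne_zero.mpr hHd)),
    twistGram_map (adeleConj L) _ (UnitaryGroup.conjMixed (↥(maximalRealSubfield L)) L (IsCMField.complexConj L)) _ (fun r => ?_) g]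
  simp only [RingHom.coe_comp, RingEquiv.toRingHom_eq_coe, RingHom.coe_coe, Function.comp_apply]
  exact ringEquiv_mixedSpace_fst_adeleConj L r

/-- **`hlocArch` — AN ARCHIMEDEAN CARTAN-CLASS IDENTITY FORCES ARCHIMEDEAN CONJUGACY** (any `γ₀`).  For matching adèles `p, q` over `γ₀` with adelic
conjugators `g, g′`, and `t ∈ GL₃(L ⊗ ℝ)` commuting with `(γ₀)_∞` such that `(x_g)_∞ = t⋆ · (x_{g′})_∞ · t`, the archimedean components
`q_∞`, `p_∞` are conjugate in `U(H)(L ⊗ ℝ)`: ★ R6a `exists_unitary_conj_of_inv_mul_twistGram_eq` over the ring `L ⊗ ℝ` after `map_arch_inv_mul_twistGram`,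
`(H ⊗ 1)_∞ = archFormOf L 3 H` (★ `map_algebraMap_map_arch`) and `p_∞ = GL₃(π_∞) p` (`toMixed_eq_map`).  Binders = the `hlocArch` socket of
★ `MatchingAdeleG₂.obsHasse_of_placewise` token for token. [cite: Rogawski1990, §3.3 (3.3.1) p. 22; §3.1 p. 19] [cite: Kottwitz1986, §7] [cite: BorelJacquet1979, §4.1] -/
theorem MatchingAdeleG₂.isConj_arch_of_placewise_cartan_eq (hHd : H.det ≠ 0) :
    ∀ (p q : MatchingAdeleG₂ L H H γ₀) (g g' : GL (Fin 3) (AdeleRing (𝓞 L) L)) (t : GL (Fin 3) (NumberField.mixedEmbedding.mixedSpace L)),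
      g * (((UnitaryGroup.cmDatum L 3 H).toAdelic γ₀).val : GL (Fin 3) (AdeleRing (𝓞 L) L)) * g⁻¹ = (p.adele.val : GL (Fin 3) (AdeleRing (𝓞 L) L)) →
      g' * (((UnitaryGroup.cmDatum L 3 H).toAdelic γ₀).val : GL (Fin 3) (AdeleRing (𝓞 L) L)) * g'⁻¹ = (q.adele.val : GL (Fin 3) (AdeleRing (𝓞 L) L)) →
      t * Matrix.GeneralLinearGroup.map ((InfiniteAdeleRing.ringEquiv_mixedSpace L).toRingHom.comp (UnitaryGroup.adeleFst L))
            (((UnitaryGroup.cmDatum L 3 H).toAdelic γ₀).val : GL (Fin 3) (AdeleRing (𝓞 L) L)) =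
        Matrix.GeneralLinearGroup.map ((InfiniteAdeleRing.ringEquiv_mixedSpace L).toRingHom.comp (UnitaryGroup.adeleFst L))
            (((UnitaryGroup.cmDatum L 3 H).toAdelic γ₀).val : GL (Fin 3) (AdeleRing (𝓞 L) L)) * t →
      ((H.map (algebraMap L (AdeleRing (𝓞 L) L)))⁻¹ * twistGram (adeleConj L) (H.map (algebraMap L (AdeleRing (𝓞 L) L))) (g : Matrix (Fin 3) (Fin 3) (AdeleRing (𝓞 L) L))).map
          ((InfiniteAdeleRing.ringEquiv_mixedSpace L).toRingHom.comp (UnitaryGroup.adeleFst L)) =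
        hermStar (UnitaryGroup.conjMixed (↥(maximalRealSubfield L)) L (IsCMField.complexConj L))
            ((H.map (algebraMap L (AdeleRing (𝓞 L) L))).map ((InfiniteAdeleRing.ringEquiv_mixedSpace L).toRingHom.comp (UnitaryGroup.adeleFst L)))
            (t.val : Matrix (Fin 3) (Fin 3) (NumberField.mixedEmbedding.mixedSpace L)) *
          ((H.map (algebraMap L (AdeleRing (𝓞 L) L)))⁻¹ * twistGram (adeleConj L) (H.map (algebraMap L (AdeleRing (𝓞 L) L))) (g' : Matrix (Fin 3) (Fin 3) (AdeleRing (𝓞 L) L))).map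
            ((InfiniteAdeleRing.ringEquiv_mixedSpace L).toRingHom.comp (UnitaryGroup.adeleFst L)) * (t.val : Matrix (Fin 3) (Fin 3) (NumberField.mixedEmbedding.mixedSpace L)) →
      IsConj q.arch p.arch := by
  intro p q g g' t hg hg' ht hx
  -- project the two conjugations along `GL₃(π_∞)`
  have hgv := congrArg (Matrix.GeneralLinearGroup.map ((InfiniteAdeleRing.ringEquiv_mixedSpace L).toRingHom.comp (UnitaryGroup.adeleFst L))) hg
  have hg'v := congrArg (Matrix.GeneralLinearGroup.map ((InfiniteAdeleRing.ringEquiv_mixedSpace L).toRingHom.comp (UnitaryGroup.adeleFst L))) hg'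
  rw [map_mul, map_mul, map_inv] at hgv hg'v
  -- read the Cartan letters at `∞`
  rw [map_arch_inv_mul_twistGram hHd, map_arch_inv_mul_twistGram hHd, ← coe_generalLinearGroup_map₃', ← coe_generalLinearGroup_map₃'] at hx
  -- ★ R6a over the ring `L ⊗ ℝ`
  obtain ⟨u, hu, huc⟩ := exists_unitary_conj_of_inv_mul_twistGram_eq (UnitaryGroup.conjMixed (↥(maximalRealSubfield L)) L (IsCMField.complexConj L))
    ((H.map (algebraMap L (AdeleRing (𝓞 L) L))).map ((InfiniteAdeleRing.ringEquiv_mixedSpace L).toRingHom.comp (UnitaryGroup.adeleFst L)))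
    (isUnit_det_adelicForm_map_arch hHd) hg'v hgv ht hx
  rw [map_algebraMap_map_arch] at hu
  have hu' : u ∈ UnitaryGroup.arch (↥(maximalRealSubfield L)) L (IsCMField.complexConj L) 3 H := by
    have h := (twistGram_coe_eq_iff_mem_unitaryGroup _ _ u).mpr hu
    rw [twistGram_def] at h
    exact h
  refine (isConj_iff.mpr ⟨⟨u, hu'⟩, Subtype.ext ?_⟩ : IsConj p.arch q.arch).symm
  change u * GLn.toMixed 3 L (p.adele.val : GL (Fin 3) (AdeleRing (𝓞 L) L)) * u⁻¹ = GLn.toMixed 3 L (q.adele.val : GL (Fin 3) (AdeleRing (𝓞 L) L))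
  rw [toMixed_eq_map, toMixed_eq_map]
  exact huc

end Arch

end Literature.NumberTheory.Rogawski1990

end
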